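import Mathlib
import Summits.ValiantsHypothesis.ValiantsHypothesis.Theorems.LacunarySymmetroidMatrixDescartesInertiaJumpPencil

/-!
# `MatrixDescartes` (stmt-ValiantsHypothesis-18050) — INERTIA KIT, III-d: MIXED TYPE — at a root whose kernel form is
# NON-DEGENERATE of signature `(p, q)` the multiplicity is EXACTLY `p + q = dim ker` and the inertia jump is EXACTLY `p − q`,
# for EVERY real symmetric lacunary pencil at EVERY format

HONEST FRAMING.  Cell `pub-symmetroid`, seat `val-sym-mdr-p2` (gen 17); helper file `--supports` the crux
`Theses.LacunarySymmetroid.MatrixDescartes`, NO closure claim.  Completes the semisimple case of the sign characteristic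
[GohbergLancasterRodman2005, Thm 12.5.2] in BOTH currencies: g16's first-order multiplicity law (`…DetMultiplicityJordanChain`)
handled non-degenerate kernel forms only through the «every kernel vector non-neutral» (= definite type) hypothesis, and the
signature law (`…InertiaJump`, `…InertiaJumpPencil`) takes splitting kernel families as data; this file shows that splitting families
`n⁻` (kernel form negative), `n⁺` (kernel form positive) with `card n⁻ + card n⁺ = dim ker F(x₀)` already EXCLUDE Jordan chains, so
`mult_{x₀} det F = p + q` while `ν` jumps by `p − q`: a mixed-type root of signature `(p, q)` contributes `p + q` roots with
multiplicity but only `|p − q|` to the inertia drift.  Nothing here bears on the crux in its window, on `stub_twoSided`, on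
`DoorA26`/`DoorA34`, registers, or `VP ≠ VNP`.

CONTENT.  `split_radical` (a vector `A + N`, `A` an `n⁻`-combination and `N` an `n⁺`-combination, that is `B`-orthogonal to both
`A` and `N` for a symmetric `B` negative on `n⁻`-combinations and positive on `n⁺`-combinations, is zero: `AᵀBA = NᵀBN` forces
both signs), `linearIndependent_split`, `exists_coeffs_of_split` (the joint family spans the kernel by rank–nullity),
`no_chain_of_split` (a Jordan chain `v·F(x₀) = 0`, `w·F(x₀) + v·F′(x₀) = 0` makes `v` `F′(x₀)`-orthogonal to the kernel, hence
`v = 0`), `pencil_rootMultiplicity_eq_of_split` (`det F ≢ 0` and `mult_{x₀} det F = card n⁻ + card n⁺`, tree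
`Multiplicity.rootMultiplicity_det_eq_corank_of_no_chain`), `pencil_jump_eq_of_split` (for `a < x₀ < b` near `x₀`:
`ν(F(b)) + card n⁺ = ν(F(a)) + card n⁻` and `π(F(a)) + card n⁺ = π(F(b)) + card n⁻`). [folklore]; axioms standard; no definitions.
-/

-- layout Summits/ValiantsHypothesis/ValiantsHypothesis forces the duplicated namespace component
set_option linter.dupNamespace false

namespace Summit.ValiantsHypothesis.ValiantsHypothesis.Theorems.LacunarySymmetroidMatrixDescartes

open Matrix Finset Polynomial
open scoped BigOperators Topology

namespace Inertia

variable {ι : Type} [Fintype ι] [DecidableEq ι]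

/-! ## §1 Splitting families of a symmetric form -/

omit [DecidableEq ι] in
/-- **Radical lemma.**  `B` symmetric, negative on the non-trivial combinations of `nm` and positive on those of `np`.  If
`v = A + N` (`A = ∑ aᵢ nmᵢ`, `N = ∑ cⱼ npⱼ`) satisfies `vᵀBA = 0` and `vᵀBN = 0`, then `a = 0` and `c = 0`. [folklore] -/
theorem split_radical {β γ : Type} [Fintype β] [Fintype γ] (B : Matrix ι ι ℝ) (hB : B.IsSymm)
    (nm : β → ι → ℝ) (np : γ → ι → ℝ)
    (hnm : ∀ a : β → ℝ, a ≠ 0 → (∑ i, a i • nm i) ⬝ᵥ (B *ᵥ ∑ i, a i • nm i) < 0)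
    (hnp : ∀ c : γ → ℝ, c ≠ 0 → 0 < (∑ j, c j • np j) ⬝ᵥ (B *ᵥ ∑ j, c j • np j))
    (a : β → ℝ) (c : γ → ℝ)
    (hA : ((∑ i, a i • nm i) + ∑ j, c j • np j) ⬝ᵥ (B *ᵥ ∑ i, a i • nm i) = 0)
    (hN : ((∑ i, a i • nm i) + ∑ j, c j • np j) ⬝ᵥ (B *ᵥ ∑ j, c j • np j) = 0) :
    a = 0 ∧ c = 0 := by
  set A := ∑ i, a i • nm i with hAdef
  set N := ∑ j, c j • np j with hNdef
  have hsymm : N ⬝ᵥ (B *ᵥ A) = A ⬝ᵥ (B *ᵥ N) := by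
    rw [Matrix.dotProduct_mulVec, ← Matrix.mulVec_transpose, hB.eq, dotProduct_comm]
  rw [add_dotProduct] at hA hN
  -- `AᵀBA = NᵀBN`
  have heq : A ⬝ᵥ (B *ᵥ A) = N ⬝ᵥ (B *ᵥ N) := by linarith
  have ha : a = 0 := by
    by_contra ha
    have h1 := hnm a ha
    have h2 : 0 ≤ N ⬝ᵥ (B *ᵥ N) := by
      by_cases hc : c = 0
      · have : N = 0 := by
          rw [hNdef]; exact Finset.sum_eq_zero fun j _ => by rw [hc, Pi.zero_apply, zero_smul]
        rw [this, zero_dotProduct]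
      · exact (hnp c hc).le
    linarith
  refine ⟨ha, ?_⟩
  by_contra hc
  have h1 := hnp c hc
  have hA0 : A = 0 := by
    rw [hAdef]; exact Finset.sum_eq_zero fun i _ => by rw [ha, Pi.zero_apply, zero_smul]
  rw [hA0, zero_dotProduct] at heq
  linarith

omit [DecidableEq ι] in
/-- **Splitting families are jointly independent.** [folklore] -/
theorem linearIndependent_split {β γ : Type} [Fintype β] [Fintype γ] (B : Matrix ι ι ℝ) (hB : B.IsSymm)
    (nm : β → ι → ℝ) (np : γ → ι → ℝ)
    (hnm : ∀ a : β → ℝ, a ≠ 0 → (∑ i, a i • nm i) ⬝ᵥ (B *ᵥ ∑ i, a i • nm i) < 0)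
    (hnp : ∀ c : γ → ℝ, c ≠ 0 → 0 < (∑ j, c j • np j) ⬝ᵥ (B *ᵥ ∑ j, c j • np j)) :
    LinearIndependent ℝ (Sum.elim nm np) := by
  rw [Fintype.linearIndependent_iff]
  intro e he
  rw [sum_elim_comb] at he
  obtain ⟨ha, hc⟩ := split_radical B hB nm np hnm hnp (fun i => e (Sum.inl i)) (fun j => e (Sum.inr j))
    (by rw [he, zero_dotProduct]) (by rw [he, zero_dotProduct])
  intro k
  rcases k with i | j
  · exact congrFun ha i
  · exact congrFun hc j

omit [DecidableEq ι] in
/-- **Splitting families span the kernel.**  Independent kernel families with `card β + card γ = dim ker A₀` reach every kernel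
vector: `A₀ v = 0 ⇒ v = ∑ aᵢ nmᵢ + ∑ cⱼ npⱼ`. [folklore] -/
theorem exists_coeffs_of_split {β γ : Type} [Fintype β] [Fintype γ] (A₀ : Matrix ι ι ℝ)
    (nm : β → ι → ℝ) (np : γ → ι → ℝ) (hli : LinearIndependent ℝ (Sum.elim nm np))
    (hnm0 : ∀ i, A₀ *ᵥ nm i = 0) (hnp0 : ∀ j, A₀ *ᵥ np j = 0)
    (hcard : Fintype.card β + Fintype.card γ = Fintype.card ι - A₀.rank)
    (v : ι → ℝ) (hv : A₀ *ᵥ v = 0) :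
    ∃ (a : β → ℝ) (c : γ → ℝ), v = (∑ i, a i • nm i) + ∑ j, c j • np j := by
  set W : Submodule ℝ (ι → ℝ) := LinearMap.ker A₀.mulVecLin with hW
  have hmem : ∀ k, Sum.elim nm np k ∈ W := by
    intro k
    rw [hW, LinearMap.mem_ker, Matrix.mulVecLin_apply]
    rcases k with i | j
    · exact hnm0 i
    · exact hnp0 j
  -- the family, viewed inside `W`, is independent of full cardinality, hence spanning
  set f : β ⊕ γ → W := fun k => ⟨Sum.elim nm np k, hmem k⟩ with hf
  have hfli : LinearIndependent ℝ f := LinearIndependent.of_comp W.subtype (by exact hli)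
  have hfin : Module.finrank ℝ W = Fintype.card (β ⊕ γ) := by
    have h1 := LinearMap.finrank_range_add_finrank_ker A₀.mulVecLin
    rw [Module.finrank_fintype_fun_eq_card] at h1
    have h2 : A₀.rank = Module.finrank ℝ (LinearMap.range A₀.mulVecLin) := rfl
    have h3 := Matrix.rank_le_card_width A₀
    rw [Fintype.card_sum, hcard, h2, ← h1, hW]
    omega
  have hspan : Submodule.span ℝ (Set.range f) = ⊤ := hfli.span_eq_top_of_card_eq_finrank' hfin.symm
  have hvW : (⟨v, by rw [hW, LinearMap.mem_ker, Matrix.mulVecLin_apply]; exact hv⟩ : W) ∈ Submodule.span ℝ (Set.range f) := by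
    rw [hspan]; exact Submodule.mem_top
  obtain ⟨e, he⟩ := (Submodule.mem_span_range_iff_exists_fun ℝ).1 hvW
  refine ⟨fun i => e (Sum.inl i), fun j => e (Sum.inr j), ?_⟩
  have h := congrArg (fun w : W => (w : ι → ℝ)) he
  simp only [Submodule.coe_sum, Submodule.coe_smul, hf] at h
  rw [← sum_elim_comb]
  exact h.symm

/-! ## §2 No Jordan chain at a root with non-degenerate kernel form -/

section Pencil

variable {κ : Type} [Fintype κ]

omit [DecidableEq ι] in
/-- **Splitting kernel families exclude Jordan chains (pencil form).**  `F(X) = ∑ₖ X^{dₖ}Sₖ` real symmetric; kernel families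
`n⁻`, `n⁺` of `F(x₀)` on whose combinations the kernel form `vᵀF′(x₀)v` is negative, resp. positive, with
`card n⁻ + card n⁺ = dim ker F(x₀)`.  Then every chain `v·F(x₀) = 0`, `w·F(x₀) + v·F′(x₀) = 0` has `v = 0`. [folklore] -/
theorem no_chain_of_split {β γ : Type} [Fintype β] [Fintype γ] (d : κ → ℕ) (S : κ → Matrix ι ι ℝ)
    (hS : ∀ k, (S k).IsSymm) (x₀ : ℝ) (nm : β → ι → ℝ) (np : γ → ι → ℝ)
    (hnm0 : ∀ j, (∑ k, x₀ ^ d k • S k) *ᵥ nm j = 0) (hnp0 : ∀ j, (∑ k, x₀ ^ d k • S k) *ᵥ np j = 0)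
    (hnm : ∀ c : β → ℝ, c ≠ 0 →
      (∑ j, c j • nm j) ⬝ᵥ ((∑ k, ((d k : ℝ) * x₀ ^ (d k - 1)) • S k) *ᵥ ∑ j, c j • nm j) < 0)
    (hnp : ∀ c : γ → ℝ, c ≠ 0 →
      0 < (∑ j, c j • np j) ⬝ᵥ ((∑ k, ((d k : ℝ) * x₀ ^ (d k - 1)) • S k) *ᵥ ∑ j, c j • np j))
    (hcard : Fintype.card β + Fintype.card γ = Fintype.card ι - (∑ k, x₀ ^ d k • S k).rank)
    (v w : ι → ℝ) (hv : v ᵥ* (∑ k, x₀ ^ d k • S k) = 0)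
    (hw : w ᵥ* (∑ k, x₀ ^ d k • S k) + v ᵥ* (∑ k, ((d k : ℝ) * x₀ ^ (d k - 1)) • S k) = 0) : v = 0 := by
  set A₀ := ∑ k, x₀ ^ d k • S k with hA₀
  set B := ∑ k, ((d k : ℝ) * x₀ ^ (d k - 1)) • S k with hBdef
  have hA₀s : A₀.IsSymm := DefiniteMoments.isSymm_eval d S hS x₀
  have hBs : B.IsSymm := by
    rw [hBdef]
    unfold Matrix.IsSymm
    rw [Matrix.transpose_sum]
    exact Finset.sum_congr rfl fun k _ => by rw [Matrix.transpose_smul, (hS k).eq]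
  have hvA : A₀ *ᵥ v = 0 := by rw [← hA₀s.eq, Matrix.mulVec_transpose]; exact hv
  -- `v` is `B`-orthogonal to the kernel
  have horth : ∀ u : ι → ℝ, A₀ *ᵥ u = 0 → v ⬝ᵥ (B *ᵥ u) = 0 := by
    intro u hu
    have h1 : v ᵥ* B = -(w ᵥ* A₀) := eq_neg_of_add_eq_zero_right hw
    calc v ⬝ᵥ (B *ᵥ u) = (v ᵥ* B) ⬝ᵥ u := Matrix.dotProduct_mulVec _ _ _
      _ = -((w ᵥ* A₀) ⬝ᵥ u) := by rw [h1, neg_dotProduct]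
      _ = -(w ⬝ᵥ (A₀ *ᵥ u)) := by rw [Matrix.dotProduct_mulVec]
      _ = 0 := by rw [hu, dotProduct_zero, neg_zero]
  have hli := linearIndependent_split B hBs nm np hnm hnp
  obtain ⟨a, c, hvac⟩ := exists_coeffs_of_split A₀ nm np hli hnm0 hnp0 hcard v hvA
  have hkerA : A₀ *ᵥ (∑ i, a i • nm i) = 0 := by
    rw [Matrix.mulVec_sum]
    exact Finset.sum_eq_zero fun i _ => by rw [Matrix.mulVec_smul, hnm0, smul_zero]
  have hkerN : A₀ *ᵥ (∑ j, c j • np j) = 0 := by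
    rw [Matrix.mulVec_sum]
    exact Finset.sum_eq_zero fun j _ => by rw [Matrix.mulVec_smul, hnp0, smul_zero]
  have h1 := horth _ hkerA
  have h2 := horth _ hkerN
  rw [hvac] at h1 h2
  obtain ⟨ha, hc⟩ := split_radical B hBs nm np hnm hnp a c h1 h2
  rw [hvac, ha, hc]
  simp

/-! ## §3 Multiplicity and jump at a mixed-type root -/

/-- **MULTIPLICITY AT A ROOT WITH NON-DEGENERATE KERNEL FORM.**  With splitting kernel families `n⁻`, `n⁺` as above
(`card n⁻ + card n⁺ = dim ker F(x₀)`): `det F ≢ 0` and `mult_{x₀} det F = card n⁻ + card n⁺`. [folklore] -/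
theorem pencil_rootMultiplicity_eq_of_split {β γ : Type} [Fintype β] [Fintype γ] (d : κ → ℕ) (S : κ → Matrix ι ι ℝ)
    (hS : ∀ k, (S k).IsSymm) (x₀ : ℝ) (nm : β → ι → ℝ) (np : γ → ι → ℝ)
    (hnm0 : ∀ j, (∑ k, x₀ ^ d k • S k) *ᵥ nm j = 0) (hnp0 : ∀ j, (∑ k, x₀ ^ d k • S k) *ᵥ np j = 0)
    (hnm : ∀ c : β → ℝ, c ≠ 0 →
      (∑ j, c j • nm j) ⬝ᵥ ((∑ k, ((d k : ℝ) * x₀ ^ (d k - 1)) • S k) *ᵥ ∑ j, c j • nm j) < 0)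
    (hnp : ∀ c : γ → ℝ, c ≠ 0 →
      0 < (∑ j, c j • np j) ⬝ᵥ ((∑ k, ((d k : ℝ) * x₀ ^ (d k - 1)) • S k) *ᵥ ∑ j, c j • np j))
    (hcard : Fintype.card β + Fintype.card γ = Fintype.card ι - (∑ k, x₀ ^ d k • S k).rank) :
    Matrix.det (∑ k, ((X : ℝ[X]) ^ d k) • (S k).map C) ≠ 0 ∧
      (Matrix.det (∑ k, ((X : ℝ[X]) ^ d k) • (S k).map C)).rootMultiplicity x₀ = Fintype.card β + Fintype.card γ := by
  have h := Multiplicity.rootMultiplicity_det_eq_corank_of_no_chain (∑ k, ((X : ℝ[X]) ^ d k) • (S k).map C) x₀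
    (fun v w hv hw => by
      rw [Multiplicity.pencil_map_eval] at hv hw
      rw [Multiplicity.pencil_map_derivative_eval] at hw
      exact no_chain_of_split d S hS x₀ nm np hnm0 hnp0 hnm hnp hcard v w hv hw)
  rw [Multiplicity.pencil_map_eval] at h
  exact ⟨h.1, h.2.trans hcard.symm⟩

/-- **THE JUMP AT A MIXED-TYPE ROOT.**  Same data: for all `a < x₀ < b` close enough to `x₀`,
`ν(F(b)) + card n⁺ = ν(F(a)) + card n⁻` and `π(F(a)) + card n⁺ = π(F(b)) + card n⁻` — the root contributes `p + q` to the count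
with multiplicity and `p − q` to the inertia drift. [folklore] -/
theorem pencil_jump_eq_of_split {β γ : Type} [Fintype β] [Fintype γ] (d : κ → ℕ) (S : κ → Matrix ι ι ℝ)
    (hS : ∀ k, (S k).IsSymm) (x₀ : ℝ) (nm : β → ι → ℝ) (np : γ → ι → ℝ)
    (hnm0 : ∀ j, (∑ k, x₀ ^ d k • S k) *ᵥ nm j = 0) (hnp0 : ∀ j, (∑ k, x₀ ^ d k • S k) *ᵥ np j = 0)
    (hnm : ∀ c : β → ℝ, c ≠ 0 →
      (∑ j, c j • nm j) ⬝ᵥ ((∑ k, ((d k : ℝ) * x₀ ^ (d k - 1)) • S k) *ᵥ ∑ j, c j • nm j) < 0)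
    (hnp : ∀ c : γ → ℝ, c ≠ 0 →
      0 < (∑ j, c j • np j) ⬝ᵥ ((∑ k, ((d k : ℝ) * x₀ ^ (d k - 1)) • S k) *ᵥ ∑ j, c j • np j))
    (hcard : Fintype.card β + Fintype.card γ = Fintype.card ι - (∑ k, x₀ ^ d k • S k).rank) :
    ∃ δ > 0, ∀ a b : ℝ, x₀ - δ < a → a < x₀ → x₀ < b → b < x₀ + δ →
      Fintype.card {j // (isHermitian_pencil d S hS b).eigenvalues j < 0} + Fintype.card γ
          = Fintype.card {j // (isHermitian_pencil d S hS a).eigenvalues j < 0} + Fintype.card β ∧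
      Fintype.card {j // 0 < (isHermitian_pencil d S hS a).eigenvalues j} + Fintype.card γ
          = Fintype.card {j // 0 < (isHermitian_pencil d S hS b).eigenvalues j} + Fintype.card β := by
  obtain ⟨G, hG, hFG, hG0⟩ := exists_pencil_firstOrder d S x₀
  rw [← hG0] at hnm hnp
  exact negIndex_jump_eq (fun x => ∑ k, x ^ d k • S k) G x₀ hG hFG (isHermitian_pencil d S hS) nm np hnm0 hnp0 hnm hnp
    hcard

end Pencil

end Inertia

end Summit.ValiantsHypothesis.ValiantsHypothesis.Theorems.LacunarySymmetroidMatrixDescartes
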